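import Summits.QuantumFields.YangMills.Theorems.BalabanUVNodesN21ExpWindowHaarMassLtOne
import Literature.MathematicalPhysics.QuantumFieldTheory.Balaban1983to89.T4AxialGaugeFixing
import Literature.MathematicalPhysics.QuantumFieldTheory.Balaban1983to89.B12SmallFieldDomain259

/-!
# N21 (NE7c) · dag-n21-w2's LOCATED-1 IN THE LANE'S OWN VOCABULARY: at a block containing the STAR of a site, the window letter `hlaw` of
# junction №3 and the STANDARD gauge-invariance letter `GaugeInvariant (cubeDensityOfDatum₉ …)` of junction №5 force the ZERO fibre law
# (`N ≥ 2`, `S ≤ π`) — the site-move invariance `hinv` of p612378 DERIVED from `GaugeField.GaugeInvariant`, its `hq` from file 18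

Width seat pub-ymgap-dag-n21-w1 (g3; director-ym №197 ∕ HUMAN RULING D-0149), node N21 = NE7c (NOT PRINTED in [Bałaban 1983–89], NOT proved), lane K3⁷
`SpineGivenEndpointR13SepCoPH` (stmt-QuantumFields-20544, `--kind proof --supports … --as helper`).  File 21 of the seat's chain.  THEOREMS ONLY: 0 `def`,
0 `sorry`; count-neutral.  Imports file 18 `…N21ExpWindowHaarMassLtOne` (p618437; brings dag-n21-w2's `…ChartRoadWindowVacuity` p612378), the tree's
`T4AxialGaugeFixing` (`siteTransf`, `gaugeAct_siteTransf_apply`) and `B12SmallFieldDomain259` (`src_ne_tgt`: a torus bond has distinct endpoints).  NO Theses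
import.  Restates nothing; composes BY NAME.

WHY.  p612378 ★★ (and file 18's ★★′) display the invariance of the block fibre density under the SITE MOVE `y ↦ (g·y on the out-bonds O of a site, y·g⁻¹ on its
in-bonds I)` as a bespoke letter `hinv` with free `O`, `I`, `b₀ ∈ O`.  When the block `b` contains EVERY bond at the site `z` (its star), that move IS the action of
the one-site gauge transformation `siteTransf z g` on the glued configuration `x ⊕_b y` (the exterior `x` is untouched because no star bond is exterior; no torus
bond is a loop, `src_ne_tgt`), so `hinv` follows from the lane's STANDARD letter `GaugeField.GaugeInvariant (cubeDensityOfDatum₉ … t a)` — the very hypothesis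
dag-n21-w2's junction №5 (`…TreeGaugeChart`, p617179) displays per cube.  Net statement: «junction №3's window letter at a block ⊇ star(z) + junction №5's
gauge-invariance letter ⇒ the fibre law is ZERO» for every `N ≥ 2`, `S ≤ π`, with NO bespoke letter left.

WHAT IS PROVED.
* §1 ([folklore], any gauge group, the `DecidableEq (PBond P j)` instance an implicit binder so that sockets stated under `Classical.decEq` unify):
  `updateFinset_siteMove_eq_gaugeAct_siteTransf` — for `b ⊇ star(z)`: gluing the moved block configuration equals `gaugeAct (siteTransf z g)` of the glued one
  (`O := {i ∈ b | src i = z}`, `I := {i ∈ b | tgt i = z}`); `siteMove_invariant_of_gaugeInvariant` — hence every `GaugeInvariant` function of the field is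
  invariant under the site move of its block fibre reading; `outBond_mem_filter_src` — the out-bond `⟨z, μ⟩` lies in `O`.
* §2 ★★″ `blockFibreLawOfDatum₉_eq_zero_of_window_of_gaugeInvariant` — (H-U), (H-ζ), averaging measurability, `2 ≤ N`, `S ≤ π`, the window factorisation
  `hlaw` of the block fibre law at `(b, x)` about `(c, S)` with weight `R`, a site `z` with `star(z) ⊆ b`, a direction `μ`, and `GaugeInvariant (cubeDensityOfDatum₉ … t a)`
  ⟹ `blockFibreLawOfDatum₉ … t a b x = 0` (file 18 ★★′ with `O`, `I`, `b₀ := ⟨z, μ⟩` supplied and `hinv` DERIVED by §1); `slotAntiConcentration_blockFibreLaw_of_window_of_gaugeInvariant`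
  — the (M1)-junk corollary.
* §3 `cubeLawOfDatum₉_eq_zero_of_blockFibreLaws_eq_zero` ([folklore] Tonelli along the block: zero fibre laws at every exterior field ⇒ the truncated law
  `cubeLawOfDatum₉ … t a` is ZERO) and ★★‴ `cubeLawOfDatum₉_eq_zero_of_windows_of_gaugeInvariant` — junction №3's window letter asked at EVERY exterior field of a
  block ⊇ star(z) + `GaugeInvariant (cubeDensityOfDatum₉ … t a)` + `2 ≤ N` + radii `≤ π` ⟹ the dressed law testing the cube `a` is the ZERO MEASURE.

HONEST FRAMING.  [folklore] + [bookkeeping] BY NAME; the printed gauge invariance of the dressed cube density ([RG-I] p.263; [III] (2.16)–(2.17)) stays a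
HYPOTHESIS, now in the standard form `GaugeField.GaugeInvariant`; the certificate is an A6 statement about the chart road's OWN letters (vacuity at blocks containing a
site star — e.g. dag-n21-d's `inputBlock a` when it holds a star), not an estimate; nothing of Bałaban's asserted; (M1) ∕ NE7c NOT PRINTED ∕ NOT proved; **N21 NOT
discharged**; K3⁷ NOT claimed; counts unmoved (typed 28∕28 · discharged 5∕27); never a count claim; one finite 𝕋⁴ at fixed ε — R4 would close only the conditional
finite-𝕋⁴ rung `BalabanLadder.UV`, NOT the Yang–Mills mass gap (Clay); nothing about ℝ⁴ ∕ OS.  No decl below carries a cite tag.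
-/

set_option autoImplicit false

noncomputable section

open scoped BigOperators ENNReal
open MeasureTheory Set Function Finset

namespace Summit.QuantumFields.YangMills.Theorems.N21ChartRoadWindowVacuityOfGaugeInvariant

open Literature.MathematicalPhysics.QuantumFieldTheory.Balaban1983to89
open Literature.MathematicalPhysics.QuantumFieldTheory.Balaban1983to89.GaugeField (gaugeAct GaugeInvariant)
open Literature.MathematicalPhysics.QuantumFieldTheory.Balaban1983to89.T4AxialGaugeFixing (siteTransf gaugeAct_siteTransf_apply)
open Literature.MathematicalPhysics.QuantumFieldTheory.Balaban1983to89.B12SmallFieldDomain259 (src_ne_tgt)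

/-! ## §1 The site move on a block containing the star of the site is a one-site gauge transformation -/

section SiteMove

variable {P : Params} {j : ℕ} {G : Type*} [GaugeGroup G]

/-- **GLUING THE MOVED BLOCK CONFIGURATION = GAUGE-TRANSFORMING THE GLUED ONE.**  If the block `b` contains every bond at the site `z`, then for
`O := {i ∈ b | src i = z}`, `I := {i ∈ b | tgt i = z}` the site move `y ↦ (g·y i on O, y i·g⁻¹ on I, y i else)` glued into the exterior `x` is
`gaugeAct (siteTransf z g)` of `x ⊕_b y` (no torus bond is a loop; no star bond is exterior).  The `DecidableEq (PBond P j)` instance is an IMPLICIT binder.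
[folklore] -/
theorem updateFinset_siteMove_eq_gaugeAct_siteTransf {instDec : DecidableEq (PBond P j)} (b : Finset (PBond P j)) (x : GaugeField P j G)
    (z : Site P j) (hstar : ∀ c : PBond P j, c.src = z ∨ c.tgt = z → c ∈ b) (g : G) (y : ↥b → G) :
    Function.updateFinset x b (fun i : ↥b =>
        (if i ∈ univ.filter (fun i : ↥b => (i : PBond P j).src = z) then (fun u : G => g * u)
          else if i ∈ univ.filter (fun i : ↥b => (i : PBond P j).tgt = z) then (fun u : G => u * g⁻¹) else id) (y i)) =
      gaugeAct (siteTransf z g) (Function.updateFinset x b y) := by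
  funext c
  rw [gaugeAct_siteTransf_apply]
  by_cases hc : c ∈ b
  · -- a block bond
    have hL : Function.updateFinset x b (fun i : ↥b =>
        (if i ∈ univ.filter (fun i : ↥b => (i : PBond P j).src = z) then (fun u : G => g * u)
          else if i ∈ univ.filter (fun i : ↥b => (i : PBond P j).tgt = z) then (fun u : G => u * g⁻¹) else id) (y i)) c =
        (if (c.src = z) then (fun u : G => g * u) else if (c.tgt = z) then (fun u : G => u * g⁻¹) else id) (y ⟨c, hc⟩) := by
      simp only [Function.updateFinset, dif_pos hc, Finset.mem_filter, Finset.mem_univ, true_and]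
    have hR : Function.updateFinset x b y c = y ⟨c, hc⟩ := by
      simp only [Function.updateFinset, dif_pos hc]
    rw [hL, hR]
    by_cases hs : c.src = z
    · have ht : c.tgt ≠ z := fun h => src_ne_tgt c (hs.trans h.symm)
      simp [hs, ht]
    · by_cases ht : c.tgt = z
      · simp [hs, ht]
      · simp [hs, ht]
  · -- an exterior bond: not at the site
    have hs : c.src ≠ z := fun h => hc (hstar c (Or.inl h))
    have ht : c.tgt ≠ z := fun h => hc (hstar c (Or.inr h))
    have hL : Function.updateFinset x b (fun i : ↥b =>
        (if i ∈ univ.filter (fun i : ↥b => (i : PBond P j).src = z) then (fun u : G => g * u)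
          else if i ∈ univ.filter (fun i : ↥b => (i : PBond P j).tgt = z) then (fun u : G => u * g⁻¹) else id) (y i)) c = x c := by
      simp only [Function.updateFinset, dif_neg hc]
    have hR : Function.updateFinset x b y c = x c := by
      simp only [Function.updateFinset, dif_neg hc]
    rw [hL, hR]
    simp [hs, ht]

/-- **A GAUGE-INVARIANT FUNCTION IS INVARIANT UNDER THE SITE MOVE OF ITS BLOCK FIBRE READING** (block ⊇ star of the site). [folklore] -/
theorem siteMove_invariant_of_gaugeInvariant {instDec : DecidableEq (PBond P j)} {α : Type*} {Gd : GaugeField P j G → α}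
    (hG : GaugeInvariant Gd) (b : Finset (PBond P j)) (x : GaugeField P j G)
    (z : Site P j) (hstar : ∀ c : PBond P j, c.src = z ∨ c.tgt = z → c ∈ b) (g : G) (y : ↥b → G) :
    Gd (Function.updateFinset x b (fun i : ↥b =>
        (if i ∈ univ.filter (fun i : ↥b => (i : PBond P j).src = z) then (fun u : G => g * u)
          else if i ∈ univ.filter (fun i : ↥b => (i : PBond P j).tgt = z) then (fun u : G => u * g⁻¹) else id) (y i))) =
      Gd (Function.updateFinset x b y) := by
  rw [updateFinset_siteMove_eq_gaugeAct_siteTransf b x z hstar g y]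
  exact hG _ _

/-- the out-bond `⟨z, μ⟩` of the site lies in `O = {i ∈ b | src i = z}`. [folklore] -/
theorem outBond_mem_filter_src (b : Finset (PBond P j)) (z : Site P j)
    (hstar : ∀ c : PBond P j, c.src = z ∨ c.tgt = z → c ∈ b) (μ : Fin P.d) :
    (⟨⟨z, μ⟩, hstar ⟨z, μ⟩ (Or.inl rfl)⟩ : ↥b) ∈ univ.filter (fun i : ↥b => (i : PBond P j).src = z) := by
  simp

end SiteMove

/-! ## §2 At the record: the window letter + `GaugeInvariant` of the cube density ⇒ the zero fibre law -/

section AtRecord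

open Literature.MathematicalPhysics.QuantumFieldTheory.Balaban1983to89.T4Continuum
open Literature.MathematicalPhysics.QuantumFieldTheory.Balaban1983to89.Node00 hiding dimSU
open T4ShellMeasure (SlotAntiConcentration)
open T4ShellMeasureDet (blockLaw)
open N21ShellSplitOfRecord13CoPH (cubeDensityOfDatum₉ blockFibreLawOfDatum₉ cubeLawOfDatum₉ cubeLawOfDatum₉_eq_withDensity measurable_cubeDensityOfDatum₉)
open N21ChartJunctionKeyed (slotAntiConcentration_of_measure_eq_zero)
open N21ExpWindowHaarMassLtOne (blockFibreLawOfDatum₉_eq_zero_of_window_of_siteInvariant_of_le_pi)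
open Summit.QuantumFields.BalabanUV.T4Continuum.ShellMeasureExpChartSUN (SUN)
open Summit.QuantumFields.BalabanUV.T4Continuum.ShellMeasureScalingSUN (windowSU)

variable (F : T4Family) (N : ℕ) [NeZero N] (ϑ : Stage9Params F N) (Dt : FiniteEpsData F (SUN N)) (g₀ : ℕ → ℝ)
  (os : List (ULoop F)) (p : B12.RunParams) (g : ℕ → ℝ) (k : ℕ)

/-- ★★″ **THE WINDOW LETTER AND THE STANDARD GAUGE-INVARIANCE LETTER FORCE THE ZERO FIBRE LAW at a block containing a site star.**
File 18 ★★′ (= dag-n21-w2's p612378 ★★ with `hq` discharged) with its bespoke site-move letter `hinv` DERIVED from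
`GaugeField.GaugeInvariant (cubeDensityOfDatum₉ … t a)` (§1) at `O := {i ∈ b | src i = z}`, `I := {i ∈ b | tgt i = z}`, `b₀ := ⟨z, μ⟩`. [bookkeeping] -/
theorem blockFibreLawOfDatum₉_eq_zero_of_window_of_gaugeInvariant (hN : 2 ≤ N)
    (hU : LocalBgMeasurable F N ϑ.ν) (hζm : ZetaMeasurable F N ϑ.ζ) (hD : Dt.AvgMeasurable) (t : ℝ)
    (a : ↥(cubeIndices (F.P p.K) (cubeSide (F.P p.K).L ϑ.ν.M₂ (RkOfRecord (F.P p.K).L ϑ.ν.r (g k)) k)))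
    (b : Finset (PBond (F.P p.K) k)) (x : GaugeField (F.P p.K) k (SUN N))
    {S : ℝ} (hSπ : S ≤ Real.pi) (c : GaugeField (F.P p.K) k (SUN N)) (R : (↥b → SUN N) → ℝ≥0∞)
    (hlaw : blockFibreLawOfDatum₉ F N ϑ Dt g₀ os p g k t a b x = (blockLaw b).withDensity fun y => windowSU b c S y * R y)
    (z : Site (F.P p.K) k) (hstar : ∀ c' : PBond (F.P p.K) k, c'.src = z ∨ c'.tgt = z → c' ∈ b) (μ : Fin (F.P p.K).d)
    (hGI : GaugeInvariant (cubeDensityOfDatum₉ F N ϑ Dt g₀ os p g k t a)) :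
    blockFibreLawOfDatum₉ F N ϑ Dt g₀ os p g k t a b x = 0 :=
  blockFibreLawOfDatum₉_eq_zero_of_window_of_siteInvariant_of_le_pi F N ϑ Dt g₀ os p g k hN hU hζm hD t a b x hSπ c R hlaw
    (univ.filter (fun i : ↥b => (i : PBond (F.P p.K) k).src = z)) (univ.filter (fun i : ↥b => (i : PBond (F.P p.K) k).tgt = z))
    (outBond_mem_filter_src b z hstar μ)
    (fun h y => siteMove_invariant_of_gaugeInvariant hGI b x z hstar h y)

/-- COROLLARY: under the same letters (M1) for the block fibre law holds for EVERY statistic and EVERY `θ ρ D` — the junk instance of the ZERO law.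
[bookkeeping] -/
theorem slotAntiConcentration_blockFibreLaw_of_window_of_gaugeInvariant (hN : 2 ≤ N)
    (hU : LocalBgMeasurable F N ϑ.ν) (hζm : ZetaMeasurable F N ϑ.ζ) (hD : Dt.AvgMeasurable) (t : ℝ)
    (a : ↥(cubeIndices (F.P p.K) (cubeSide (F.P p.K).L ϑ.ν.M₂ (RkOfRecord (F.P p.K).L ϑ.ν.r (g k)) k)))
    (b : Finset (PBond (F.P p.K) k)) (x : GaugeField (F.P p.K) k (SUN N))
    {S : ℝ} (hSπ : S ≤ Real.pi) (c : GaugeField (F.P p.K) k (SUN N)) (R : (↥b → SUN N) → ℝ≥0∞)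
    (hlaw : blockFibreLawOfDatum₉ F N ϑ Dt g₀ os p g k t a b x = (blockLaw b).withDensity fun y => windowSU b c S y * R y)
    (z : Site (F.P p.K) k) (hstar : ∀ c' : PBond (F.P p.K) k, c'.src = z ∨ c'.tgt = z → c' ∈ b) (μ : Fin (F.P p.K).d)
    (hGI : GaugeInvariant (cubeDensityOfDatum₉ F N ϑ Dt g₀ os p g k t a))
    (u : (↥b → SUN N) → ℝ) (θ ρ D : ℝ) :
    SlotAntiConcentration (blockFibreLawOfDatum₉ F N ϑ Dt g₀ os p g k t a b x) u θ ρ D :=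
  slotAntiConcentration_of_measure_eq_zero
    (blockFibreLawOfDatum₉_eq_zero_of_window_of_gaugeInvariant F N ϑ Dt g₀ os p g k hN hU hζm hD t a b x hSπ c R hlaw z hstar μ hGI) u θ ρ D

/-! ## §3 … hence, if the letters hold at EVERY exterior field, the truncated cube law itself is the ZERO measure -/

/-- **ZERO FIBRES EVERYWHERE ⇒ ZERO TRUNCATED LAW** (Tonelli along the block, Mathlib `lintegral_eq_of_lmarginal_eq`; the truncated law is product Haar with the
summed density, dag-n21-d `cubeLawOfDatum₉_eq_withDensity`). [folklore] -/
theorem cubeLawOfDatum₉_eq_zero_of_blockFibreLaws_eq_zero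
    (hU : LocalBgMeasurable F N ϑ.ν) (hζm : ZetaMeasurable F N ϑ.ζ) (hD : Dt.AvgMeasurable) (t : ℝ)
    (a : ↥(cubeIndices (F.P p.K) (cubeSide (F.P p.K).L ϑ.ν.M₂ (RkOfRecord (F.P p.K).L ϑ.ν.r (g k)) k)))
    (b : Finset (PBond (F.P p.K) k)) (hzero : ∀ x : GaugeField (F.P p.K) k (SUN N), blockFibreLawOfDatum₉ F N ϑ Dt g₀ os p g k t a b x = 0) :
    cubeLawOfDatum₉ F N ϑ Dt g₀ os p g k t a = 0 := by
  letI := Classical.decEq (PBond (F.P p.K) k)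
  have hGm := measurable_cubeDensityOfDatum₉ F N ϑ Dt g₀ os p g k hU hζm hD t a
  rw [cubeLawOfDatum₉_eq_withDensity F N ϑ Dt g₀ os p g k hU hζm hD t a, ← Measure.measure_univ_eq_zero,
    withDensity_apply _ MeasurableSet.univ, Measure.restrict_univ]
  -- the field measure is product Haar; integrate along the block first
  show ∫⁻ V, cubeDensityOfDatum₉ F N ϑ Dt g₀ os p g k t a V ∂(Measure.pi fun _ : PBond (F.P p.K) k => (HaarData.haar : Measure (SUN N))) = 0
  have hmarg : (∫⋯∫⁻_b, cubeDensityOfDatum₉ F N ϑ Dt g₀ os p g k t a ∂fun _ : PBond (F.P p.K) k => (HaarData.haar : Measure (SUN N))) =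
      (∫⋯∫⁻_b, (fun _ : GaugeField (F.P p.K) k (SUN N) => (0 : ℝ≥0∞)) ∂fun _ : PBond (F.P p.K) k => (HaarData.haar : Measure (SUN N))) := by
    funext x
    have hx := congrArg (fun ν : Measure (↥b → SUN N) => ν univ) (hzero x)
    simp only [Measure.coe_zero, Pi.zero_apply] at hx
    have h1 : blockFibreLawOfDatum₉ F N ϑ Dt g₀ os p g k t a b x univ =
        ∫⁻ y, cubeDensityOfDatum₉ F N ϑ Dt g₀ os p g k t a (Function.updateFinset x b y)
          ∂(Measure.pi fun _ : ↥b => (HaarData.haar : Measure (SUN N))) := by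
      show ((Measure.pi fun _ : ↥b => (HaarData.haar : Measure (SUN N))).withDensity
          (fun y => cubeDensityOfDatum₉ F N ϑ Dt g₀ os p g k t a (Function.updateFinset x b y))) univ = _
      rw [withDensity_apply _ MeasurableSet.univ, Measure.restrict_univ]
    rw [h1] at hx
    simp only [lmarginal, lintegral_zero]
    exact hx
  rw [lintegral_eq_of_lmarginal_eq b hGm measurable_const hmarg, lintegral_zero]

/-- ★★‴ **THE WINDOW LETTER AT EVERY EXTERIOR FIELD + THE STANDARD GAUGE-INVARIANCE LETTER ⇒ THE TRUNCATED CUBE LAW IS ZERO** (block ⊇ star of a site, `N ≥ 2`,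
windows of radii `S x ≤ π` about centres `c x` with weights `R x`): junction №3's per-fibre window letter asked at such a block, together with junction №5's
`GaugeInvariant (cubeDensityOfDatum₉ … t a)`, is inhabited only when the dressed law testing the cube `a` is the ZERO MEASURE. [bookkeeping] -/
theorem cubeLawOfDatum₉_eq_zero_of_windows_of_gaugeInvariant (hN : 2 ≤ N)
    (hU : LocalBgMeasurable F N ϑ.ν) (hζm : ZetaMeasurable F N ϑ.ζ) (hD : Dt.AvgMeasurable) (t : ℝ)
    (a : ↥(cubeIndices (F.P p.K) (cubeSide (F.P p.K).L ϑ.ν.M₂ (RkOfRecord (F.P p.K).L ϑ.ν.r (g k)) k)))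
    (b : Finset (PBond (F.P p.K) k))
    (S : GaugeField (F.P p.K) k (SUN N) → ℝ) (hSπ : ∀ x, S x ≤ Real.pi)
    (c : GaugeField (F.P p.K) k (SUN N) → GaugeField (F.P p.K) k (SUN N))
    (R : GaugeField (F.P p.K) k (SUN N) → (↥b → SUN N) → ℝ≥0∞)
    (hlaw : ∀ x, blockFibreLawOfDatum₉ F N ϑ Dt g₀ os p g k t a b x = (blockLaw b).withDensity fun y => windowSU b (c x) (S x) y * R x y)
    (z : Site (F.P p.K) k) (hstar : ∀ c' : PBond (F.P p.K) k, c'.src = z ∨ c'.tgt = z → c' ∈ b) (μ : Fin (F.P p.K).d)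
    (hGI : GaugeInvariant (cubeDensityOfDatum₉ F N ϑ Dt g₀ os p g k t a)) :
    cubeLawOfDatum₉ F N ϑ Dt g₀ os p g k t a = 0 :=
  cubeLawOfDatum₉_eq_zero_of_blockFibreLaws_eq_zero F N ϑ Dt g₀ os p g k hU hζm hD t a b fun x =>
    blockFibreLawOfDatum₉_eq_zero_of_window_of_gaugeInvariant F N ϑ Dt g₀ os p g k hN hU hζm hD t a b x (hSπ x) (c x) (R x)
      (hlaw x) z hstar μ hGI

end AtRecord

end Summit.QuantumFields.YangMills.Theorems.N21ChartRoadWindowVacuityOfGaugeInvariant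

end
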